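import Summits.QuantumFields.Balaban3D.Proofs.Bound55AC

/-!
# `Summit.QuantumFields.Balaban3D.Proofs.WindowAC` — the (48)–(49) step RE-RUN WITH THE TRIVIAL HISTORY'S FIBRE FACTOR WINDOWED on a generic AC
# tower input, and the Radon–Nikodym support lemma behind it — lane `pub-balaban3d`, seat alpha-1 (towards print's `χ_{k+1}` of (40)–(41) for crux
# `HistoryTailL` of route `UnitScaleTilt`, STUB 2‴ `stub_windowedTrivialWeight` of line v5p3)

WHY.  The lane's (41) functional `LF_{k+1}(V)[Φ] = Σ_{h′} m_{k+1}(h′,V)·e^{Φ(h′)}` carries NO window on the current field `V`: the masses are the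
exact transports `m_{k+1}(h′) = T_k[w_k(h′)·m_k(proj h′)]` (`MassesAC.massRecAC_succ`; at the trivial history floored, `max 1 (T_k[m_k(triv)])`,
`w_k(triv) ≡ 1` by `Carriers.stepWeight_triv`), and the small-field factor on `B(Λ_{k+1}) = Ω_{k+1}(h′)` — seat p4's `Bound55Masses.chiB` — sits
on the LEFT of the fibre residual `Bound55AC.Fibre49AC` only (print's (55) p.269 carries `χ_{k+1}` on the right).  The consumer of the T³ socket
(crux `HistoryTailL`, line v5p3, STUB 2‴) needs the trivial-history term of (41) supported in the charged window.  THIS FILE is the generic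
measure-theoretic core of what the frozen rows give: §1 a Radon–Nikodym SUPPORT lemma (the transport of a density supported in `Ū⁻¹(Wn)` vanishes
`dV`-a.e. off `Wn`), and §2 the (48)–(49) step of `TransportAC.transport41_le_sum_ae_of_ac` re-run on a generic AC tower input with the new masses
kept as the RAW transports and the trivial history's fibre factor multiplied by `𝟙_{Wn}` whenever the step weight times the `B(Λ_{k+1})`-factor of
the trivial history vanishes unless `Ū ∈ Wn`.  The lane/T³ instantiation (window from [Balaban1985Averaging] Prop. 1, exponent bookkeeping, the
honesty of the version selection) is `Summits/QuantumFields/YangMills/Theorems/AlphaInputsT3ACv2RecWindow`.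

WHAT THIS IS NOT (seat findings F-α1-10/F-α1-11): no window for the NON-trivial histories (their masses confine the current field only on the ring
`Λ_k` and on `P_k`, `Carriers.stepWeight`; a window on `Ω_{k+1}(h′)` needs a LOCAL form of Prop. 1 not in the tree), and no cut-off-uniform bound on
the windowed trivial weight (the floors below level `k` compound; the `K`-uniform form needs the (β) residual in mass-generic form).  [folklore]
measure theory; nothing of [Balaban1985UV3] is asserted — the (β) content stays the hypothesis `hfibre` (= the row `Fibre49AC`).

References: T. Bałaban, Commun. Math. Phys. 102 (1985) 255–275 [Balaban1985UV3] ((40)–(41) p.266, (48)–(49) pp.267–268, (55) p.269, (58) p.270);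
Commun. Math. Phys. 98 (1985) 17–51 [Balaban1985Averaging] (Prop. 1 (51) p.26).
-/

noncomputable section

namespace Summit.QuantumFields.Balaban3D.Proofs.WindowAC

open _root_.MeasureTheory
open Literature.MathematicalPhysics.QuantumFieldTheory.Balaban1983to89
open Literature.MathematicalPhysics.QuantumFieldTheory.Balaban1983to89.AveragingRT (rnTransport rnTransport_nonneg)
open Literature.MathematicalPhysics.QuantumFieldTheory.Balaban1983to89.B10 (Ineq41)
open Literature.MathematicalPhysics.QuantumFieldTheory.Balaban1983to89.B10SectAGathering
open Literature.MathematicalPhysics.QuantumFieldTheory.Balaban1985CMP102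
open Literature.MathematicalPhysics.QuantumFieldTheory.Balaban1985CMP102.Setting
open Summit.QuantumFields.Balaban3D.Carriers
open Summit.QuantumFields.Balaban3D.Proofs.Transport48 (rnTransport_mono_ae integrable_weight_mul)
open Summit.QuantumFields.Balaban3D.Proofs.TransportAC
open Summit.QuantumFields.Balaban3D.Proofs.Bound55Masses (chiB chiB_nonneg chiB_le_one measurable_chiB measurable_stepWeight rnTransport_zero_ae)
open Summit.QuantumFields.Balaban3D.Proofs.MassesAC
open Summit.QuantumFields.Balaban3D.Proofs.TowerAC
open Summit.QuantumFields.Balaban3D.Proofs.SeriesAC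
open Summit.QuantumFields.Balaban3D.Proofs.StandardAC
open Summit.QuantumFields.Balaban3D.Proofs.Bound55AC

/-! ## §1 A Radon–Nikodym support lemma: the transport of a density supported in `Ū⁻¹(Wn)` vanishes `dV`-a.e. off `Wn` -/

section Support

variable {P : Params} {j : ℕ} {G : Type} [GaugeGroup G] [MeasurableSpace G] [HaarData G]
  {avg : GaugeField P j G → GaugeField P (j + 1) G}

/-- **SUPPORT OF THE RN TRANSPORT**: under `AvgAC`, if the non-negative integrable density `φ` vanishes wherever `Ū ∉ Wn` (`Wn` measurable),
then `T[φ](V) = 0` for `dV`-a.e. `V ∉ Wn` — the push-forward identity `∫ T[φ]·f dV = ∫ φ·(f∘Ū) dU` tested at `f = 𝟙_{Wnᶜ}`, where the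
right side vanishes, and `T[φ] ≥ 0`. [folklore] -/
theorem rnTransport_ae_eq_zero_off (hac : AvgAC avg) {φ : Density P j G} (h0 : ∀ U, 0 ≤ φ U)
    (hφ : Integrable φ (fieldMeasure P j G)) {Wn : Set (GaugeField P (j + 1) G)} (hWn : MeasurableSet Wn)
    (hsupp : ∀ U, φ U ≠ 0 → avg U ∈ Wn) :
    ∀ᵐ V ∂(fieldMeasure P (j + 1) G), V ∉ Wn → rnTransport avg φ V = 0 := by
  classical
  have hRT := isRT_rnTransport_of_ac hac φ hφ
  have hf : Measurable (Wnᶜ.indicator fun _ : GaugeField P (j + 1) G => (1 : ℝ)) :=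
    measurable_const.indicator hWn.compl
  have hfb : ∃ C : ℝ, ∀ V, |Wnᶜ.indicator (fun _ : GaugeField P (j + 1) G => (1 : ℝ)) V| ≤ C :=
    ⟨1, fun V => by by_cases hV : V ∈ Wnᶜ <;> simp [Set.indicator, hV]⟩
  have hid := hRT _ hf hfb
  have hrhs : ∫ U, φ U * Wnᶜ.indicator (fun _ : GaugeField P (j + 1) G => (1 : ℝ)) (avg U) ∂(fieldMeasure P j G) = 0 := by
    refine integral_eq_zero_of_ae (ae_of_all _ fun U => ?_)
    by_cases hφU : φ U = 0
    · simp [hφU]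
    · have hmem : avg U ∉ Wnᶜ := fun h => h (hsupp U hφU)
      simp [Set.indicator, hmem]
  rw [hrhs] at hid
  have hnn : 0 ≤ᵐ[fieldMeasure P (j + 1) G] fun V => rnTransport avg φ V * Wnᶜ.indicator (fun _ => (1 : ℝ)) V :=
    ae_of_all _ fun V => mul_nonneg (rnTransport_nonneg avg φ h0 V) (Set.indicator_nonneg (fun _ _ => zero_le_one) V)
  have hint : Integrable (fun V => rnTransport avg φ V * Wnᶜ.indicator (fun _ => (1 : ℝ)) V) (fieldMeasure P (j + 1) G) := by
    refine (integrable_rnTransport avg φ hφ).mul_bdd hf.aestronglyMeasurable (c := 1) (ae_of_all _ fun V => ?_)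
    by_cases hV : V ∈ Wnᶜ <;> simp [Set.indicator, hV]
  have hz := (integral_eq_zero_iff_of_nonneg_ae hnn hint).mp hid
  filter_upwards [hz] with V hV hVn
  have hVc : V ∈ Wnᶜ := hVn
  have h1 : rnTransport avg φ V * 1 = 0 := by simpa [Set.indicator, hVc] using hV
  simpa using h1

/-- The windowed form: under the same hypotheses `T[φ] = 𝟙_{Wn}·T[φ]` `dV`-a.e. [folklore] -/
theorem rnTransport_ae_eq_indicator_mul (hac : AvgAC avg) {φ : Density P j G} (h0 : ∀ U, 0 ≤ φ U)
    (hφ : Integrable φ (fieldMeasure P j G)) {Wn : Set (GaugeField P (j + 1) G)} (hWn : MeasurableSet Wn)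
    (hsupp : ∀ U, φ U ≠ 0 → avg U ∈ Wn) :
    rnTransport avg φ =ᵐ[fieldMeasure P (j + 1) G] fun V => Wn.indicator (fun _ => (1 : ℝ)) V * rnTransport avg φ V := by
  classical
  filter_upwards [rnTransport_ae_eq_zero_off hac h0 hφ hWn hsupp] with V hV
  by_cases hVW : V ∈ Wn
  · simp [Set.indicator, hVW]
  · simp [Set.indicator, hVW, hV hVW]

end Support

/-! ## §2 The (48)–(49) step with the TRIVIAL history's fibre factor WINDOWED (generic AC tower input) -/

section Step

variable {L : ℕ} {S : Scales L} {G : Type} [GaugeGroup G] [MeasurableSpace G] [HaarData G] [RegularGaugeGroup G]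
  (D : TowerInputAC S G) (slot : ℕ → Prop) (k : ℕ)

/-- **(48)–(49) ⇒ (55)·(58), `dV`-a.e., WITH THE TRIVIAL TERM WINDOWED** — `Bound55AC.transport_rho_le_lf_ae` re-run with the new masses kept as
the RAW transports `T_k[w_k(h′)·m_k(proj h′)]` and, for `h′ = triv`, the fibre factor multiplied by `𝟙_{Wn}`: if the step weight times the
`B(Λ_{k+1})`-factor of the trivial history vanishes unless `Ū ∈ Wn` (`hsupp`), then the transported fluctuation integrand of the trivial history
is supported in `Wn` (`rnTransport_ae_eq_zero_off`), so `T_kρ_k ≤ Σ_{h′} T_k[w·m](V)·(𝟙_{Wn}(V) if h′ = triv)·e^{(55)·(58) exponent}` a.e.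
The (β) content is the hypothesis `hfibre` (the lane's residual R3D-01). [cite: Balaban1985UV3, (48)–(49) pp.267–268 + (55) p.269 + (58) p.270] -/
theorem transport_rho_le_windowed_ae [DecidableEq (Hist S.P (k + 1))] (P : StepPieces (D.towerWith slot).toTowerRun k)
    (hac : AvgAC (D.av k).avg)
    (w χB : Hist S.P (k + 1) → Density S.P k G)
    (hw : ∀ h', Measurable (w h')) (hw0 : ∀ h' U, 0 ≤ w h' U) (hw1 : ∀ h' U, w h' U ≤ 1)
    (hχ : ∀ h', Measurable (χB h')) (hχ0 : ∀ h' U, 0 ≤ χB h' U) (hχ1 : ∀ h' U, χB h' U ≤ 1)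
    (hcover : ∀ (h : Hist S.P k) (U : GaugeField S.P k G), D.W.mass k h U ≠ 0 →
      ∃ h' : Hist S.P (k + 1), h'.proj = h ∧ (1 : ℝ) ≤ w h' U * χB h' U)
    (hint : ∀ h : Hist S.P k, Integrable (fun U => D.W.mass k h U *
      Real.exp (-((D.towerWith slot).mainT k h U) + D.Pint k h U - (D.towerWith slot).Ecst k
        + (D.towerWith slot).Zterm k h + (D.towerWith slot).Rm k)) (fieldMeasure S.P k G))
    (hfibre : ∀ h' : Hist S.P (k + 1),
      (rnTransport (D.av k).avg (fun U => w h' U * χB h' U * (D.W.mass k h'.proj U *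
        Real.exp (-((D.towerWith slot).mainT k h'.proj U) + D.Pint k h'.proj U - (D.towerWith slot).Ecst k
          + (D.towerWith slot).Zterm k h'.proj + (D.towerWith slot).Rm k))))
      ≤ᵐ[fieldMeasure S.P (k + 1) G] fun V => rnTransport (D.av k).avg (fun U => w h' U * D.W.mass k h'.proj U) V *
        Real.exp (-((D.towerWith slot).mainT (k + 1) h' V) - (D.towerWith slot).Ecst k
          + (P.logσ₀ + P.dg * Real.log (S.gk k)) * P.starB h' + P.logZU h' V + P.Pold h' V
          + (D.towerWith slot).Zterm k (P.proj h') + (D.towerWith slot).Rm k + P.logFl h' V))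
    (h41 : Ineq41 (D.towerWith slot).toTowerRun k)
    (Wn : Set (GaugeField S.P (k + 1) G)) (hWn : MeasurableSet Wn)
    (hsupp : ∀ U : GaugeField S.P k G,
      w (Hist.triv S.P (k + 1)) U * χB (Hist.triv S.P (k + 1)) U ≠ 0 → (D.av k).avg U ∈ Wn) :
    ∀ᵐ V ∂(fieldMeasure S.P (k + 1) G), rnTransport (D.av k).avg ((D.towerWith slot).rho k) V ≤
      ∑ h' : Hist S.P (k + 1), rnTransport (D.av k).avg (fun U => w h' U * D.W.mass k h'.proj U) V *
        ((if h' = Hist.triv S.P (k + 1) then Wn.indicator (fun _ => (1 : ℝ)) V else 1) *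
          Real.exp (-((D.towerWith slot).mainT (k + 1) h' V) - (D.towerWith slot).Ecst k
            + (P.logσ₀ + P.dg * Real.log (S.gk k)) * P.starB h' + P.logZU h' V + P.Pold h' V
            + (D.towerWith slot).Zterm k (P.proj h') + (D.towerWith slot).Rm k + P.logFl h' V)) := by
  classical
  have h41' : ∀ U : GaugeField S.P k G, (D.towerWith slot).rho k U ≤ ∑ h : Hist S.P k, D.W.mass k h U *
      Real.exp (-((D.towerWith slot).mainT k h U) + D.Pint k h U - (D.towerWith slot).Ecst k
        + (D.towerWith slot).Zterm k h + (D.towerWith slot).Rm k) := fun U => h41 U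
  have hρ : Integrable ((D.towerWith slot).rho k) (fieldMeasure S.P k G) := run3_rho_integrable (D.toRunInput slot) k
  -- the fibre inequality with the window inserted at the trivial history
  have hfibre' : ∀ h' : Hist S.P (k + 1),
      (rnTransport (D.av k).avg (fun U => w h' U * χB h' U * (D.W.mass k h'.proj U *
        Real.exp (-((D.towerWith slot).mainT k h'.proj U) + D.Pint k h'.proj U - (D.towerWith slot).Ecst k
          + (D.towerWith slot).Zterm k h'.proj + (D.towerWith slot).Rm k))))
      ≤ᵐ[fieldMeasure S.P (k + 1) G] fun V => rnTransport (D.av k).avg (fun U => w h' U * D.W.mass k h'.proj U) V *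
        ((if h' = Hist.triv S.P (k + 1) then Wn.indicator (fun _ => (1 : ℝ)) V else 1) *
          Real.exp (-((D.towerWith slot).mainT (k + 1) h' V) - (D.towerWith slot).Ecst k
            + (P.logσ₀ + P.dg * Real.log (S.gk k)) * P.starB h' + P.logZU h' V + P.Pold h' V
            + (D.towerWith slot).Zterm k (P.proj h') + (D.towerWith slot).Rm k + P.logFl h' V)) := by
    intro h'
    by_cases ht : h' = Hist.triv S.P (k + 1)
    · subst ht
      have h0 : ∀ U, 0 ≤ w (Hist.triv S.P (k + 1)) U * χB (Hist.triv S.P (k + 1)) U *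
          (D.W.mass k (Hist.triv S.P (k + 1)).proj U *
            Real.exp (-((D.towerWith slot).mainT k (Hist.triv S.P (k + 1)).proj U) + D.Pint k (Hist.triv S.P (k + 1)).proj U
              - (D.towerWith slot).Ecst k + (D.towerWith slot).Zterm k (Hist.triv S.P (k + 1)).proj + (D.towerWith slot).Rm k)) :=
        fun U => mul_nonneg (mul_nonneg (hw0 _ U) (hχ0 _ U)) (mul_nonneg (D.W.mass_nonneg k _ U) (Real.exp_pos _).le)
      have hi := integrable_weight_mul (hw (Hist.triv S.P (k + 1))) (hχ (Hist.triv S.P (k + 1))) (hw0 (Hist.triv S.P (k + 1)))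
        (hw1 (Hist.triv S.P (k + 1))) (hχ0 (Hist.triv S.P (k + 1))) (hχ1 (Hist.triv S.P (k + 1))) (hint (Hist.triv S.P (k + 1)).proj)
      have hs : ∀ U, w (Hist.triv S.P (k + 1)) U * χB (Hist.triv S.P (k + 1)) U *
          (D.W.mass k (Hist.triv S.P (k + 1)).proj U *
            Real.exp (-((D.towerWith slot).mainT k (Hist.triv S.P (k + 1)).proj U) + D.Pint k (Hist.triv S.P (k + 1)).proj U
              - (D.towerWith slot).Ecst k + (D.towerWith slot).Zterm k (Hist.triv S.P (k + 1)).proj + (D.towerWith slot).Rm k)) ≠ 0 →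
          (D.av k).avg U ∈ Wn := by
        intro U hU
        refine hsupp U fun hz => hU ?_
        rw [hz, zero_mul]
      have hzero := rnTransport_ae_eq_zero_off hac h0 hi hWn hs
      filter_upwards [hfibre (Hist.triv S.P (k + 1)), hzero] with V hV hZ
      rw [if_pos rfl]
      by_cases hVW : V ∈ Wn
      · rw [Set.indicator_of_mem hVW, one_mul]
        exact hV
      · rw [hZ hVW, Set.indicator_of_notMem hVW, zero_mul, mul_zero]
    · filter_upwards [hfibre h'] with V hV
      rw [if_neg ht, one_mul]
      exact hV
  have hB : ∀ (h' : Hist S.P (k + 1)) (V : GaugeField S.P (k + 1) G),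
      0 ≤ (if h' = Hist.triv S.P (k + 1) then Wn.indicator (fun _ => (1 : ℝ)) V else 1) *
          Real.exp (-((D.towerWith slot).mainT (k + 1) h' V) - (D.towerWith slot).Ecst k
            + (P.logσ₀ + P.dg * Real.log (S.gk k)) * P.starB h' + P.logZU h' V + P.Pold h' V
            + (D.towerWith slot).Zterm k (P.proj h') + (D.towerWith slot).Rm k + P.logFl h' V) := by
    intro h' V
    refine mul_nonneg ?_ (Real.exp_pos _).le
    split_ifs
    · exact Set.indicator_nonneg (fun _ _ => zero_le_one) V
    · exact zero_le_one
  exact transport41_le_sum_ae_of_ac hac (Hist.proj (P := S.P) (k := k)) ((D.towerWith slot).rho k) hρ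
    (D.W.mass k) (fun h U => -((D.towerWith slot).mainT k h U) + D.Pint k h U - (D.towerWith slot).Ecst k
        + (D.towerWith slot).Zterm k h + (D.towerWith slot).Rm k)
    w χB (fun h' => rnTransport (D.av k).avg (fun U => w h' U * D.W.mass k h'.proj U))
    (fun h' V => (if h' = Hist.triv S.P (k + 1) then Wn.indicator (fun _ => (1 : ℝ)) V else 1) *
          Real.exp (-((D.towerWith slot).mainT (k + 1) h' V) - (D.towerWith slot).Ecst k
            + (P.logσ₀ + P.dg * Real.log (S.gk k)) * P.starB h' + P.logZU h' V + P.Pold h' V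
            + (D.towerWith slot).Zterm k (P.proj h') + (D.towerWith slot).Rm k + P.logFl h' V))
    h41' hint (D.W.mass_nonneg k) hw hw0 hw1 hχ hχ0 hχ1 hcover (fun h' => ae_of_all _ fun V => le_rfl) hB hfibre'

end Step




end Summit.QuantumFields.Balaban3D.Proofs.WindowAC

end
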